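import Literature.Topology.PlaneTopology.Janiszewski
import Literature.Probability.RandomPlanarGeometry.CaratheodoryExtension
import HarnessLib

/-!
# Carathéodory's continuity theorem for domains with locally connected complement

Trunk T-STOCH (complex analysis / plane topology). Pommerenke's Theorem 2.1, implication
(iv) ⇒ (i), proved under the **uniform-continuum form** of hypothesis (iv) that Pommerenke's
proof actually uses (op. cit. §2.2 (1), with `A = ℂ ∖ G`): for every `ε > 0` there is `δ > 0`
such that any two points of `∂G` at distance `< δ` lie in a compact connected subset of `ℂ ∖ G`
contained in the closed `ε`-disc about the first of them (hypothesis `hlc` below). Conclusion: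
**a conformal equivalence `φ` of the unit disc onto such a bounded open `G` extends
continuously to the closed disc.** The reduction of `hlc` from the bare statement "`ℂ ∖ G` is
locally connected" (a compactness argument) is *not* formalised here; `hlc` is verified
directly where the theorem is applied (Jordan domains: `CaratheodoryContinuity.lean`, from a
short boundary arc; complements of Loewner hulls generated by curves: `LoewnerTraceLimit.lean`).

Proof (Pommerenke, p. 21): Wolff's length–area lemma
(`Literature.Analysis.Complex.LengthArea.exists_short_crosscut_of_isBounded`) gives short crosscuts
`C = φ(𝔻 ∩ {|w - ζ| = r})` near every `ζ ∈ ∂𝔻`, with endpoints `a, b ∈ ∂G` close together;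
`hlc` joins them by a small continuum `σ ⊆ ℂ ∖ G`; by **Janiszewski's theorem**
(`Literature.Topology.PlaneTopology.janiszewski'`, `Literature/Topology/PlaneTopology/Janiszewski.lean`) the near side
`φ(𝔻 ∩ {|w - ζ| < r})` lies in the small disc containing `C ∪ σ`
(`image_inter_ball_subset_of_subset_compl`: if some `w = φ z`, `|z - ζ| < r`, were far from `a`,
then `w` and `φ 0` would be separated neither by the compact set `A = C̄ ∪ σ` (both lie in the
connected exterior of the disc) nor by `B = (ℂ ∖ G) ∩ B̄(0, R₁)` (both lie in the connected
set `G`), and `A ∩ B = σ` is connected; by Janiszewski they are joined by a connected set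
missing `A ∪ B`, inside `G ∖ C`; pulling back by `φ⁻¹` contradicts the intermediate value
theorem for `|· - ζ|`), so `φ` oscillates little near `ζ` (`exists_forall_dist_lt_of_lc`) and
`extendFrom 𝔻 φ` is continuous on the closed disc (`ConformalEquiv.continuousOn_extendFrom_of_lc`).
This file is the primary home of the argument; the Jordan-domain statements of
`CaratheodoryContinuity.lean` are corollaries.

Refactor note (librarian): `JordanDomain.continuousAt_symm`, `.mem_frontier_of_tendsto`,
`.mem_crosscut`, `.endpoints_mem_frontier` of `CaratheodoryExtension.lean` are the special cases
`G = D.carrier` of the `ConformalEquiv.*` lemmas below and should become one-line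
specialisations of them (that file is maintained by another item; not edited here).

## References

* Ch. Pommerenke, *Boundary Behaviour of Conformal Maps*, Springer (1992), §2.2, Thm. 2.1
  ((iv) ⇒ (i)) and its proof, Prop. 2.2; §1.1 (Janiszewski's theorem).
-/

noncomputable section

open Set Filter Metric Topology Complex Real Bornology
open scoped NNReal

namespace Literature.Probability.RandomPlanarGeometry

/-- The exterior `{R < dist z a}` of a closed disc is preconnected. [folklore] -/
theorem isPreconnected_setOf_lt_dist (a : ℂ) {R : ℝ} (hR : 0 ≤ R) :
    IsPreconnected {z : ℂ | R < dist z a} := by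
  have h := (Literature.Topology.PlaneTopology.isConnected_setOf_lt_norm hR).isPreconnected.image (fun w ↦ a + w) (by fun_prop)
  convert h using 1
  ext w
  simp only [mem_setOf_eq, mem_image, dist_eq_norm]
  constructor
  · intro hw; exact ⟨w - a, hw, by ring⟩
  · rintro ⟨w', hw', rfl⟩; simpa using hw'

namespace ConformalEquiv

open Literature.Analysis.Complex.LengthArea

variable {G : Set ℂ} (φ : ConformalEquiv (ball (0 : ℂ) 1) G) {ζ : ℂ} {r : ℝ}

/-- The inverse of a conformal equivalence onto an open set is continuous at points of the
target. [folklore] -/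
theorem continuousAt_symm (hG : IsOpen G) {y : ℂ} (hy : y ∈ G) : ContinuousAt φ.symm y :=
  (φ.symm.continuousOn y hy).continuousAt (hG.mem_nhds hy)

/-- **Boundary limits are boundary points.** If `g → x` with `‖x‖ = 1` along a filter, `g`
eventually in the disc, and `φ ∘ g → a`, then `a ∈ ∂G`. [folklore] -/
theorem mem_frontier_of_tendsto (hG : IsOpen G) {ι : Type*} {l : Filter ι} [NeBot l] {g : ι → ℂ}
    (hg : ∀ᶠ t in l, g t ∈ ball (0 : ℂ) 1) {x : ℂ} (hx : ‖x‖ = 1) (hgx : Tendsto g l (𝓝 x))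
    {a : ℂ} (ha : Tendsto (fun t ↦ φ (g t)) l (𝓝 a)) : a ∈ frontier G := by
  have hcl : a ∈ closure G := mem_closure_of_tendsto ha (hg.mono fun t ht ↦ φ.mapsTo ht)
  rw [closure_eq_interior_union_frontier, hG.interior_eq] at hcl
  refine hcl.resolve_left fun haD ↦ ?_
  have h1 : Tendsto (fun t ↦ φ.symm (φ (g t))) l (𝓝 (φ.symm a)) :=
    (continuousAt_symm φ hG haD).tendsto.comp ha
  have h2 : Tendsto (fun t ↦ φ.symm (φ (g t))) l (𝓝 x) :=
    hgx.congr' (hg.mono fun t ht ↦ (φ.symm_apply_apply ht).symm)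
  have := tendsto_nhds_unique h1 h2
  have hmem := φ.symm_mapsTo haD
  rw [this, mem_ball_zero_iff, hx] at hmem
  exact lt_irrefl _ hmem

/-- Points of the disc at distance exactly `r` from `ζ` are on the crosscut. [folklore] -/
theorem mem_crosscut (hζ : ‖ζ‖ = 1) (hr : r ∈ Ioo (0 : ℝ) 1) {x : ℂ} (hx : x ∈ ball (0 : ℂ) 1)
    (hxr : ‖x - ζ‖ = r) :
    φ x ∈ (fun t ↦ φ (cpt ζ r t)) '' Ioo (-arccos (r / 2)) (arccos (r / 2)) := by
  obtain ⟨t, ht, rfl⟩ := exists_eq_cpt hζ hr.1 hxr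
  have habs : |t| ≤ π := abs_le.2 ⟨ht.1.le, ht.2⟩
  have := (mem_ball_cpt_iff_abs_lt hζ hr.1 (by linarith [hr.2]) habs).1 hx
  exact ⟨t, abs_lt.1 this, rfl⟩

/-- The endpoints of a crosscut are boundary points. [folklore] -/
theorem endpoints_mem_frontier (hG : IsOpen G) (hζ : ‖ζ‖ = 1) (hr : r ∈ Ioo (0 : ℝ) 1) {a b : ℂ}
    (ha : Tendsto (fun t ↦ φ (cpt ζ r t)) (𝓝[>] (-arccos (r / 2))) (𝓝 a))
    (hb : Tendsto (fun t ↦ φ (cpt ζ r t)) (𝓝[<] (arccos (r / 2))) (𝓝 b)) :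
    a ∈ frontier G ∧ b ∈ frontier G := by
  set α := arccos (r / 2) with hα
  have hαpos : 0 < α := arccos_pos.2 (by linarith [hr.2])
  have hαpi : α ≤ π := arccos_le_pi _
  have hmem : ∀ t ∈ Ioo (-α) α, cpt ζ r t ∈ ball (0 : ℂ) 1 := fun t ht ↦ by
    have habs : |t| < α := abs_lt.2 ht
    exact (mem_ball_cpt_iff_abs_lt hζ hr.1 (by linarith [hr.2]) (habs.le.trans hαpi)).2 habs
  constructor
  · refine mem_frontier_of_tendsto φ hG (l := 𝓝[>] (-α)) ?_ (JordanDomain.norm_cpt_arccos hζ hr (-α) (by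
      rw [abs_neg, abs_of_pos hαpos])) ?_ ha
    · filter_upwards [Ioo_mem_nhdsGT (by linarith : -α < α)] with t ht using hmem t ht
    · exact ((continuous_cpt ζ r).tendsto (-α)).mono_left nhdsWithin_le_nhds
  · refine mem_frontier_of_tendsto φ hG (l := 𝓝[<] α) ?_ (JordanDomain.norm_cpt_arccos hζ hr α
      (abs_of_pos hαpos)) ?_ hb
    · filter_upwards [Ioo_mem_nhdsLT (by linarith : -α < α)] with t ht using hmem t ht
    · exact ((continuous_cpt ζ r).tendsto α).mono_left nhdsWithin_le_nhds

/-- **The near side of a short crosscut is small** (via Janiszewski's theorem). Let `C` be the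
crosscut `t ↦ φ (ζ - ζ r e^{it})`, `|t| < arccos (r/2)`, with endpoints `a, b`, let
`σ ⊆ ℂ ∖ G` be a compact preconnected set containing `a` and `b`, all contained in the closed
disc of radius `R` about `a`, and suppose `dist (φ 0) a > R`. Then `φ` maps
`𝔻 ∩ {|w - ζ| < r}` into that disc. Pommerenke (1992), proof of Thm. 2.1 ((iv) ⇒ (i)), with
Janiszewski's theorem. [cite: PommerenkeBBCM1992, Thm. 2.1] -/
theorem image_inter_ball_subset_of_subset_compl (hG : IsOpen G) (hGb : IsBounded G)
    (hζ : ‖ζ‖ = 1) (hr : r ∈ Ioo (0 : ℝ) 1)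
    {a b : ℂ} (ha : Tendsto (fun t ↦ φ (cpt ζ r t)) (𝓝[>] (-arccos (r / 2))) (𝓝 a))
    (hb : Tendsto (fun t ↦ φ (cpt ζ r t)) (𝓝[<] (arccos (r / 2))) (𝓝 b))
    {σ : Set ℂ} (hσc : IsPreconnected σ) (hσK : IsCompact σ) (hσG : σ ⊆ Gᶜ)
    (haσ : a ∈ σ) (hbσ : b ∈ σ) {R : ℝ}
    (hRc : ∀ t ∈ Ioo (-arccos (r / 2)) (arccos (r / 2)), dist (φ (cpt ζ r t)) a ≤ R)
    (hRσ : σ ⊆ closedBall a R) (hfar : R < dist (φ 0) a) :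
    φ '' (ball 0 1 ∩ ball ζ r) ⊆ closedBall a R := by
  set α := arccos (r / 2) with hα
  have hαpos : 0 < α := arccos_pos.2 (by linarith [hr.2])
  have hαpi : α ≤ π := arccos_le_pi _
  have hR0 : 0 ≤ R := dist_nonneg.trans (hRσ hbσ)
  have hmem : ∀ t ∈ Ioo (-α) α, cpt ζ r t ∈ ball (0 : ℂ) 1 := fun t ht ↦ by
    have habs : |t| < α := abs_lt.2 ht
    exact (mem_ball_cpt_iff_abs_lt hζ hr.1 (by linarith [hr.2]) (habs.le.trans hαpi)).2 habs
  set c : ℝ → ℂ := fun t ↦ φ (cpt ζ r t) with hc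
  set C : Set ℂ := c '' Ioo (-α) α with hCdef
  have hCD : C ⊆ G := by
    rintro _ ⟨t, ht, rfl⟩
    exact φ.mapsTo (hmem t ht)
  have hCR : C ⊆ closedBall a R := by
    rintro _ ⟨t, ht, rfl⟩
    exact mem_closedBall.2 (hRc t ht)
  -- the closed crosscut `C̄ = C ∪ {a, b}` as a continuous image of `[-α, α]`
  have hcc : ContinuousOn c (Ioo (-α) α) :=
    φ.continuousOn.comp (continuous_cpt ζ r).continuousOn hmem
  have hlt : -α < α := by linarith
  set cbar : ℝ → ℂ := extendFrom (Ioo (-α) α) c with hcbar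
  have hcbar_c : ContinuousOn cbar (Icc (-α) α) := continuousOn_Icc_extendFrom_Ioo hcc ha hb
  have hcbar_a : cbar (-α) = a := eq_lim_at_left_extendFrom_Ioo hlt ha
  have hcbar_b : cbar α = b := eq_lim_at_right_extendFrom_Ioo hlt hb
  have hcbar_eq : ∀ t ∈ Ioo (-α) α, cbar t = c t := fun t ht ↦
    extendFrom_extends hcc t ht
  set Cbar : Set ℂ := cbar '' Icc (-α) α with hCbar
  have hCbarK : IsCompact Cbar := (isCompact_Icc).image_of_continuousOn hcbar_c
  have hCbar_sub : Cbar ⊆ C ∪ {a, b} := by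
    rintro _ ⟨t, ht, rfl⟩
    rcases eq_or_lt_of_le ht.1 with h1 | h1
    · exact Or.inr (Or.inl (by rw [← h1, hcbar_a]))
    rcases eq_or_lt_of_le ht.2 with h2 | h2
    · exact Or.inr (Or.inr (by rw [h2, hcbar_b]; exact mem_singleton b))
    · exact Or.inl ⟨t, ⟨h1, h2⟩, (hcbar_eq t ⟨h1, h2⟩).symm⟩
  have hC_sub : C ⊆ Cbar := by
    rintro _ ⟨t, ht, rfl⟩
    exact ⟨t, Ioo_subset_Icc_self ht, hcbar_eq t ht⟩
  -- the two compact sets of Janiszewski's theorem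
  set A : Set ℂ := Cbar ∪ σ with hA
  have hAK : IsCompact A := hCbarK.union hσK
  have hAR : A ⊆ closedBall a R := by
    refine union_subset (hCbar_sub.trans (union_subset hCR ?_)) hRσ
    rintro x (rfl | rfl)
    · exact mem_closedBall_self hR0
    · exact hRσ hbσ
  obtain ⟨R₁, hR₁⟩ := (isBounded_iff_subset_closedBall 0).1 (hGb.union hσK.isBounded)
  set B : Set ℂ := Gᶜ ∩ closedBall 0 R₁ with hB
  have hBK : IsCompact B := (isCompact_closedBall 0 R₁).inter_left hG.isClosed_compl
  have hDR₁ : G ⊆ closedBall 0 R₁ := subset_union_left.trans hR₁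
  have hσB : σ ⊆ B := fun x hx ↦ ⟨hσG hx, hR₁ (Or.inr hx)⟩
  have hAB : A ∩ B = σ := by
    refine Subset.antisymm ?_ fun x hx ↦ ⟨Or.inr hx, hσB hx⟩
    rintro x ⟨hxA, hxB⟩
    rcases hxA with hxC | hxσ
    · rcases hCbar_sub hxC with hxC' | (rfl | rfl)
      · exact absurd (hCD hxC') hxB.1
      · exact haσ
      · exact hbσ
    · exact hxσ
  -- suppose some `w = φ z` of the near side is far from `a`
  rintro w ⟨z, ⟨hz, hzr⟩, rfl⟩
  by_contra hwR
  rw [mem_closedBall, not_le] at hwR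
  have h0D : φ 0 ∈ G := φ.mapsTo (mem_ball_self one_pos)
  have hwD : φ z ∈ G := φ.mapsTo hz
  have hGc : IsPreconnected G := by
    rw [← φ.bijOn.image_eq]
    exact (convex_ball (0 : ℂ) 1).isPreconnected.image _ φ.continuousOn
  -- neither `A` nor `B` separates `φ 0` from `φ z`
  have hSA : ∃ S ⊆ Aᶜ, IsPreconnected S ∧ φ 0 ∈ S ∧ φ z ∈ S :=
    ⟨{x | R < dist x a}, fun x hx hxA ↦ (not_le.2 hx) (mem_closedBall.1 (hAR hxA)),
      isPreconnected_setOf_lt_dist a hR0, hfar, hwR⟩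
  have hSB : ∃ S ⊆ Bᶜ, IsPreconnected S ∧ φ 0 ∈ S ∧ φ z ∈ S :=
    ⟨G, fun x hx hxB ↦ hxB.1 hx, hGc, h0D, hwD⟩
  obtain ⟨V, hV, hVc, h0V, hwV⟩ :=
    Literature.Topology.PlaneTopology.janiszewski' hAK hBK (hAB ▸ hσc) hSA hSB
  -- `V ⊆ G ∖ C`
  have hVD : V ⊆ G := by
    have hcov : V ⊆ G ∪ (closedBall (0 : ℂ) R₁)ᶜ := by
      intro x hx
      by_cases hxD : x ∈ G
      · exact Or.inl hxD
      · exact Or.inr fun hxR ↦ hV hx (Or.inr ⟨hxD, hxR⟩)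
    refine hVc.subset_left_of_subset_union hG isClosed_closedBall.isOpen_compl ?_ hcov
      ⟨φ 0, h0V, h0D⟩
    exact Set.disjoint_left.2 fun x hxD hxR ↦ hxR (hDR₁ hxD)
  have hVC : ∀ x ∈ V, x ∉ C := fun x hx hxC ↦ hV hx (Or.inl (Or.inl (hC_sub hxC)))
  -- pull back to the disc and apply the intermediate value theorem to `|· - ζ|`
  set V' : Set ℂ := φ.symm '' V with hV'
  have hV'c : IsPreconnected V' := hVc.image _ (φ.symm.continuousOn.mono hVD)
  have hV'ball : V' ⊆ ball 0 1 := by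
    rintro _ ⟨x, hx, rfl⟩
    exact φ.symm_mapsTo (hVD hx)
  have h0V' : (0 : ℂ) ∈ V' := ⟨φ 0, h0V, φ.symm_apply_apply (mem_ball_self one_pos)⟩
  have hzV' : z ∈ V' := ⟨φ z, hwV, φ.symm_apply_apply hz⟩
  have hfc : ContinuousOn (fun x : ℂ ↦ ‖x - ζ‖) V' := by fun_prop
  have hfz : ‖z - ζ‖ < r := by rwa [mem_ball, dist_eq_norm] at hzr
  have hf0 : ‖(0 : ℂ) - ζ‖ = 1 := by rw [zero_sub, norm_neg, hζ]
  obtain ⟨u, huV', hur⟩ : ∃ u ∈ V', ‖u - ζ‖ = r := by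
    have := hV'c.intermediate_value hzV' h0V' hfc ⟨hfz.le, by rw [hf0]; exact hr.2.le⟩
    obtain ⟨u, hu, hur⟩ := this
    exact ⟨u, hu, hur⟩
  obtain ⟨x, hxV, rfl⟩ := huV'
  have hxD : x ∈ G := hVD hxV
  have hφu : φ (φ.symm x) = x := φ.apply_symm_apply hxD
  have hmemC : φ (φ.symm x) ∈ C := mem_crosscut φ hζ hr (hV'ball ⟨x, hxV, rfl⟩) hur
  rw [hφu] at hmemC
  exact hVC x hxV hmemC


/-- **Equicontinuity at boundary points** for domains with locally connected complement: for
every `ε₀ > 0` there is `ρ > 0` such that `φ` oscillates by less than `ε₀` on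
`𝔻 ∩ {|w - ζ| < ρ}`, for every `ζ ∈ ∂𝔻`. Pommerenke (1992), proof of Thm. 2.1, (iv) ⇒ (i).
[cite: PommerenkeBBCM1992, Thm. 2.1] -/
theorem exists_forall_dist_lt_of_lc (hG : IsOpen G) (hGb : IsBounded G)
    (hlc : ∀ ε > 0, ∃ δ > 0, ∀ a ∈ frontier G, ∀ b ∈ frontier G, dist a b < δ →
      ∃ σ ⊆ Gᶜ, IsCompact σ ∧ IsPreconnected σ ∧ a ∈ σ ∧ b ∈ σ ∧ σ ⊆ closedBall a ε)
    (hζ : ‖ζ‖ = 1) {ε₀ : ℝ} (hε₀ : 0 < ε₀) :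
    ∃ ρ > 0, ∀ z ∈ ball (0 : ℂ) 1, dist z ζ < ρ → ∀ z' ∈ ball (0 : ℂ) 1, dist z' ζ < ρ →
      dist (φ z) (φ z') < ε₀ := by
  -- `φ 0` is at positive distance `d₀` from `∂G`
  obtain ⟨d₀, hd₀, hballΩ⟩ := Metric.isOpen_iff.1 hG (φ 0) (φ.mapsTo (mem_ball_self one_pos))
  have hfarJ : ∀ a ∈ frontier G, d₀ ≤ dist (φ 0) a := fun a ha ↦ by
    by_contra h
    have haG : a ∈ G := hballΩ (by rw [mem_ball']; exact not_le.1 h)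
    rw [frontier, hG.interior_eq] at ha
    exact ha.2 haG
  set η := min (ε₀ / 4) (d₀ / 2) with hη
  have hηpos : 0 < η := lt_min (by linarith) (by linarith)
  obtain ⟨ε₁, hε₁, harc⟩ := hlc η hηpos
  set ε := min (ε₁ / 2) η with hε
  have hεpos : 0 < ε := lt_min (by linarith) hηpos
  have hbdd : IsBounded (φ '' ball 0 1) := by rw [φ.bijOn.image_eq]; exact hGb
  obtain ⟨r, hr, -, a, b, ha, hb, hRc, hRb⟩ :=
    exists_short_crosscut_of_isBounded φ.differentiableOn φ.injOn hbdd hζ hεpos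
  obtain ⟨haJ, hbJ⟩ := endpoints_mem_frontier φ hG hζ hr ha hb
  obtain ⟨σ, hσG, hσK, hσc, haσ, hbσ, hRσ⟩ := harc a haJ b hbJ (hRb.trans_lt (by
    calc ε ≤ ε₁ / 2 := min_le_left _ _
      _ < ε₁ := by linarith))
  have hεη : ε ≤ η := min_le_right _ _
  have hW := image_inter_ball_subset_of_subset_compl φ hG hGb hζ hr ha hb hσc hσK hσG haσ hbσ
    (R := η) (fun t ht ↦ (hRc t ht).trans hεη) hRσ (by
      calc η ≤ d₀ / 2 := min_le_right _ _
        _ < d₀ := by linarith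
        _ ≤ dist (φ 0) a := hfarJ a haJ)
  refine ⟨r, hr.1, fun z hz hzr z' hz' hz'r ↦ ?_⟩
  have h1 : φ z ∈ closedBall a η := hW ⟨z, ⟨hz, hzr⟩, rfl⟩
  have h2 : φ z' ∈ closedBall a η := hW ⟨z', ⟨hz', hz'r⟩, rfl⟩
  rw [mem_closedBall] at h1 h2
  calc dist (φ z) (φ z') ≤ dist (φ z) a + dist (φ z') a := dist_triangle_right _ _ _
    _ ≤ η + η := add_le_add h1 h2
    _ ≤ ε₀ / 4 + ε₀ / 4 := add_le_add (min_le_left _ _) (min_le_left _ _)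
    _ < ε₀ := by linarith

/-- Under the hypotheses of `exists_forall_dist_lt_of_lc`, `φ` has a limit within the disc at
every point of the closed disc. [cite: PommerenkeBBCM1992, Thm. 2.1] -/
theorem exists_tendsto_of_lc (hG : IsOpen G) (hGb : IsBounded G)
    (hlc : ∀ ε > 0, ∃ δ > 0, ∀ a ∈ frontier G, ∀ b ∈ frontier G, dist a b < δ →
      ∃ σ ⊆ Gᶜ, IsCompact σ ∧ IsPreconnected σ ∧ a ∈ σ ∧ b ∈ σ ∧ σ ⊆ closedBall a ε)
    {x : ℂ} (hx : x ∈ closedBall (0 : ℂ) 1) : ∃ y, Tendsto φ (𝓝[ball 0 1] x) (𝓝 y) := by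
  rcases eq_or_lt_of_le (mem_closedBall_zero_iff.1 hx) with h | h
  · have hζcl : x ∈ closure (ball (0 : ℂ) 1) := by
      rw [closure_ball 0 one_ne_zero, mem_closedBall_zero_iff, h]
    haveI : NeBot (𝓝[ball (0 : ℂ) 1] x) := mem_closure_iff_nhdsWithin_neBot.1 hζcl
    have hC : Cauchy (map φ (𝓝[ball (0 : ℂ) 1] x)) := by
      rw [Metric.cauchy_iff]
      refine ⟨inferInstance, fun ε hε ↦ ?_⟩
      obtain ⟨ρ, hρ, hρ'⟩ := exists_forall_dist_lt_of_lc φ hG hGb hlc h hε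
      refine ⟨φ '' (ball 0 1 ∩ ball x ρ),
        image_mem_map (inter_mem_nhdsWithin _ (ball_mem_nhds x hρ)), ?_⟩
      rintro _ ⟨z, ⟨hz, hzρ⟩, rfl⟩ _ ⟨z', ⟨hz', hz'ρ⟩, rfl⟩
      exact hρ' z hz hzρ z' hz' hz'ρ
    obtain ⟨y, hy⟩ := CompleteSpace.complete hC
    exact ⟨y, hy⟩
  · exact ⟨φ x, φ.continuousOn x (mem_ball_zero_iff.2 h)⟩

/-- **Carathéodory's continuity theorem for domains with locally connected complement**
(Pommerenke (1992), Thm. 2.1, (iv) ⇒ (i)): if `G` is a bounded open set and any two nearby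
points of `∂G` lie in a small continuum inside `ℂ ∖ G`, then every conformal equivalence
`φ : 𝔻 → G` extends continuously to the closed disc: `extendFrom 𝔻 φ` is continuous on `𝔻̄`,
agrees with `φ` on `𝔻`, and is the limit of `φ` at every point of `𝔻̄`. Proved from Wolff's
length–area lemma and Janiszewski's theorem. [cite: PommerenkeBBCM1992, Thm. 2.1] -/
theorem continuousOn_extendFrom_of_lc (hG : IsOpen G) (hGb : IsBounded G)
    (hlc : ∀ ε > 0, ∃ δ > 0, ∀ a ∈ frontier G, ∀ b ∈ frontier G, dist a b < δ →
      ∃ σ ⊆ Gᶜ, IsCompact σ ∧ IsPreconnected σ ∧ a ∈ σ ∧ b ∈ σ ∧ σ ⊆ closedBall a ε) :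
    ContinuousOn (extendFrom (ball 0 1) φ) (closedBall (0 : ℂ) 1) ∧
      (∀ x ∈ ball (0 : ℂ) 1, extendFrom (ball 0 1) φ x = φ x) ∧
      ∀ x ∈ closedBall (0 : ℂ) 1, Tendsto φ (𝓝[ball 0 1] x) (𝓝 (extendFrom (ball 0 1) φ x)) :=
  ⟨_root_.continuousOn_extendFrom (by rw [closure_ball 0 one_ne_zero])
      fun _ hx ↦ exists_tendsto_of_lc φ hG hGb hlc hx,
    fun x hx ↦ extendFrom_extends φ.continuousOn x hx,
    fun _ hx ↦ _root_.tendsto_extendFrom (exists_tendsto_of_lc φ hG hGb hlc hx)⟩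

end ConformalEquiv

end Literature.Probability.RandomPlanarGeometry
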